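import Literature.Geometry.DiscreteGeometry.KissingRigidity
import HarnessLib

/-!
# Cone certificates (1/3): the integer certificate FORMAT `ConeCert m` and its Boolean check

Helper for `stmt-Ventures-19480` (per-ball programme E1 of cf-p1 ROUTE.md §80).  The ε-tube lemma
`eq_of_coneMargin` (file `…GenericWallFloorTubeLemma.lean`) needs, per own-pattern `O`, the
hypothesis: for every tangent field `v` at the exact completion `s` and every free ball `i₀`, some
ACTIVE contact is violated to first order by `≥ κ ‖v i₀‖`.  This file defines an INTEGER
certificate format `ConeCert m` for that hypothesis and its Boolean check `ConeCert.check` (one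
`decide` per orbit); the bridge `ConeCert.margin` / `ConeCert.eq_slots` (check = true ⇒ the margin
hypothesis with the rational constant `κ₀ = kapNum / kapDen`, hence the exact completion is the only
admissible one in the tube) is in `…ConeCertificate.lean` (3/3), the `ℝ³` frame lemmas and the sharper
tube lemma `eq_of_coneMargin_sharp` in `…ConeCertificateFrame.lean` (2/3).


Format (all integers; slots and own vectors at a common scale `√N`, e.g. `N = 2` for the
cuboctahedron, `18` for the anticuboctahedron in the frame of `hcpInt`):
* `slot i` — the exact position of free ball `i`;  `ownVec c`, `ownBall c` — the active own
  contacts (`2·slot·own = N`);  `freeA c`, `freeB c` — the active free contacts;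
* `tau i a` (`a : Fin 2`) — an integer orthogonal tangent frame at `slot i`, with the frame identity
  `nS n₀ n₁ e_k = n₀ n₁ σ_k σ + nS n₁ τ₀_k τ₀ + nS n₀ τ₁_k τ₁` on the three basis vectors;
* for every `(i₀, a, sign)`: nonnegative multipliers `lamO`, `lamF` on the contacts, `r > 0` and
  `mu : Fin m → ℤ` with the per-ball identity
  `Σ_{own c at i} lamO c • ownVec c + Σ_{free c, A c = i} lamF c • slot (B c) + Σ_{free c, B c = i} lamF c • slot (A c)
     = mu i • slot i + [i = i₀] r • (±tau i₀ a)` —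
  i.e. `Σ_c λ_c L_c = r ⟨·_{i₀}, ±τ⟩` as functionals on tangent fields (Farkas / LP dual form);
* `kapNum, kapDen`: the claimed bound, checked by `kapNum² Λ² 2N ≤ r² n_{i₀,a} kapDen²` for every
  `(i₀, a, sign)`, where `Λ = Σ lamO + Σ lamF`, `n_{i₀,a} = |tau i₀ a|²`.
Then `κ₀ ‖v i₀‖ ≤ max_c L_c(v)` for all tangent `v` (proof: `v i₀` lies in the tangent plane
spanned by `τ₀, τ₁` — three pairwise orthogonal nonzero vectors exhaust `ℝ³` — so some signed
`⟨v i₀, ±τ_a⟩/√n_a ≥ ‖v i₀‖/√2`; the functional identity and `λ ≥ 0` give a contact `c` with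
`L_c(v) ≥ (r/Λ)⟨v i₀, ±τ_a⟩/… `).


lit g11 (crystal3d-full; HOME/cf-lit/lean/conecert/, evidence #55 on stmt-Ventures-19480), landed verbatim
(split in three files for the 400-line rule) by prover 19480-p2.  Data: `…ConeCertData*.lean` (kit j291074/j291568,
`cert/gencert.py`): every own-pattern orbit with `|O| ≥ 6` (fcc and hcp) except the two flexible ones
(C12-924, A12-603), and the P₅ capper pattern, each with one `decide`.
-/

noncomputable section

namespace Summit.Ventures.Crystal3D.Theorems

open Finset Literature.Geometry.DiscreteGeometry
open scoped RealInnerProductSpace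


/-! ### Integer vectors in `ℝ³` -/

/-- The inner product with an integer vector, in coordinates. -/
theorem inner_intVec_right (x : (EuclideanSpace ℝ (Fin 3))) (v : Fin 3 → ℤ) :
    ⟪x, intVec v⟫ = x 0 * v 0 + x 1 * v 1 + x 2 * v 2 := by
  simp [intVec, PiLp.inner_apply, Fin.sum_univ_three, mul_comm]

/-- `intVec` commutes with natural-number scalar multiplication. -/
theorem intVec_nsmul (k : ℕ) (v : Fin 3 → ℤ) : intVec (k • v) = (k : ℝ) • intVec v := by
  ext i; simp [intVec]

/-- `intVec 0 = 0`. -/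
theorem intVec_zero : intVec (0 : Fin 3 → ℤ) = 0 := by
  ext i; simp [intVec]

/-- `intVec` commutes with finite sums. -/
theorem intVec_sum {α : Type*} (S : Finset α) (f : α → (Fin 3 → ℤ)) :
    intVec (∑ c ∈ S, f c) = ∑ c ∈ S, intVec (f c) := by
  classical
  induction S using Finset.induction_on with
  | empty => simp [intVec_zero]
  | insert a S ha ih => rw [Finset.sum_insert ha, Finset.sum_insert ha, intVec_add, ih]

/-- A nonzero integer vector has nonzero image in `ℝ³`. -/
theorem intVec_ne_zero {v : Fin 3 → ℤ} (h : v ≠ 0) : intVec v ≠ 0 := by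
  intro h0; apply h; exact intVec_injective (by rw [h0, intVec_zero])

/-- The standard basis vector `e_k` as an integer vector. -/
def ibasis (k : Fin 3) : Fin 3 → ℤ := fun j => if j = k then 1 else 0

/-! ### The certificate format -/

/-- An integer certificate for the first-order cone margin of an exact kissing completion with
`m` free balls (see the module docstring for the meaning of the fields). -/
structure ConeCert (m : ℕ) where
  N : ℕ
  slot : Fin m → (Fin 3 → ℤ)
  nO : ℕ
  ownBall : Fin nO → Fin m
  ownVec : Fin nO → (Fin 3 → ℤ)
  nF : ℕ
  freeA : Fin nF → Fin m
  freeB : Fin nF → Fin m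
  tau : Fin m → Fin 2 → (Fin 3 → ℤ)
  lamO : Fin m → Fin 2 → Bool → Fin nO → ℕ
  lamF : Fin m → Fin 2 → Bool → Fin nF → ℕ
  r : Fin m → Fin 2 → Bool → ℕ
  mu : Fin m → Fin 2 → Bool → Fin m → ℤ
  kapNum : ℕ
  kapDen : ℕ

namespace ConeCert

variable {m : ℕ} (C : ConeCert m)

/-- `±1` from a sign flag. -/
def sgn (b : Bool) : ℤ := if b then 1 else -1

/-- `sgn true = 1`. -/
@[simp] theorem sgn_true : sgn true = 1 := rfl

/-- `sgn false = −1`. -/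
@[simp] theorem sgn_false : sgn false = -1 := rfl

/-- Total multiplier weight `Λ` of the certificate for `(i₀, a, b)`. -/
def Lam (i₀ : Fin m) (a : Fin 2) (b : Bool) : ℕ :=
  (∑ c : Fin C.nO, C.lamO i₀ a b c) + ∑ c : Fin C.nF, C.lamF i₀ a b c

/-- The combined gradient at ball `i` of the weighted active constraints. -/
def grad (i₀ : Fin m) (a : Fin 2) (b : Bool) (i : Fin m) : Fin 3 → ℤ :=
  (∑ c : Fin C.nO, if C.ownBall c = i then C.lamO i₀ a b c • C.ownVec c else 0) +
    (∑ c : Fin C.nF, if C.freeA c = i then C.lamF i₀ a b c • C.slot (C.freeB c) else 0) +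
    ∑ c : Fin C.nF, if C.freeB c = i then C.lamF i₀ a b c • C.slot (C.freeA c) else 0

/-- The validity check of a certificate (a `Bool`, evaluated by `decide`; see `ConeCert.margin` for
what it certifies). -/
def check (C : ConeCert m) : Bool := decide (
  0 < C.N ∧
  (∀ i : Fin m, dotInt (C.slot i) (C.slot i) = C.N) ∧
  (∀ c : Fin C.nO, 2 * dotInt (C.slot (C.ownBall c)) (C.ownVec c) = C.N ∧
    dotInt (C.ownVec c) (C.ownVec c) = C.N) ∧
  (∀ c : Fin C.nF, C.freeA c ≠ C.freeB c ∧ 2 * dotInt (C.slot (C.freeA c)) (C.slot (C.freeB c)) = C.N) ∧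
  (∀ i : Fin m, C.slot i ≠ 0 ∧ C.tau i 0 ≠ 0 ∧ C.tau i 1 ≠ 0 ∧
    dotInt (C.slot i) (C.tau i 0) = 0 ∧ dotInt (C.slot i) (C.tau i 1) = 0 ∧ dotInt (C.tau i 0) (C.tau i 1) = 0) ∧
  (∀ i₀ : Fin m, ∀ a : Fin 2, ∀ b : Bool,
    0 < C.r i₀ a b ∧ 0 < C.Lam i₀ a b ∧
    (∀ i : Fin m, C.grad i₀ a b i =
      C.mu i₀ a b i • C.slot i + (if i = i₀ then ((C.r i₀ a b : ℤ) * sgn b) • C.tau i₀ a else 0)) ∧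
    ((C.kapNum : ℤ) ^ 2 * (C.Lam i₀ a b : ℤ) ^ 2 * 2 * C.N ≤
      (C.r i₀ a b : ℤ) ^ 2 * dotInt (C.tau i₀ a) (C.tau i₀ a) * (C.kapDen : ℤ) ^ 2)) ∧
  0 < C.kapDen ∧ 0 < C.kapNum ∧ C.kapNum ≤ 3 * C.kapDen)

/-- The real slot vectors `s i = slot i / √N`. -/
def s (i : Fin m) : (EuclideanSpace ℝ (Fin 3)) := (Real.sqrt C.N)⁻¹ • intVec (C.slot i)

/-- The real own vectors of the active own contacts. -/
def ownSet : Finset (EuclideanSpace ℝ (Fin 3)) := Finset.univ.image fun c : Fin C.nO => (Real.sqrt C.N)⁻¹ • intVec (C.ownVec c)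

/-- The certified margin `κ₀ = kapNum / kapDen`. -/
def kappa : ℝ := (C.kapNum : ℝ) / C.kapDen

end ConeCert

end Summit.Ventures.Crystal3D.Theorems

end
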